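import Literature.Probability.RandomPlanarGeometry.SLERestrictionAlive
import Literature.Probability.RandomPlanarGeometry.RestrictionDensityLoewner
import Literature.Probability.RandomPlanarGeometry.SLEKappaRhoRestriction
import HarnessLib

/-!
# The event "the closed Loewner hulls have not reached the compact set `N`" is measurable

Generalisation of `SLERestrictionAlive` (G. F. Lawler, O. Schramm, W. Werner, *Conformal
restriction: the chordal case*, JAMS **16** (2003), §5, `T = T_A`; there `N = A` is a nonempty
`*`-hull) to an arbitrary COMPACT set `N` of the closed half-plane with `0 ∉ N` which is the
closure of its part in `ℍ` — e.g. the closed `ρ`-neighbourhood in `ℍ̄` of a cluster of a `*`-hull,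
the "sensor" of the through-swallow horizon of the locality of SLE₆ (Lawler (2005) §6.3). For a
family of continuous driving functions `W ω` from `0` whose values at times `≤ t` are measurable:

* `Loewner.disjoint_closedHull_iff_lt_hullHitTime_of_isCompact` — the alive times of a compact set
  are exactly `[0, T_N)` (at the finite hitting time a point of `N` is swallowed,
  `IsHullHitTime.exists_mem_closedHull`);
* `Loewner.disjoint_closedHull_iff_aliveFn_pos_of_isCompact` — the alive event is `{0 < aliveFn}`
  for the alive functional of a sequence of points of `N ∩ ℍ` dense in `N` (alive ⇒ positive by
  the joint continuity of `(s, z) ↦ g_s(z)` on the compact `[0, t] × N`; not alive ⇒ `aliveFn < ε`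
  verbatim as in `SLERestrictionAlive`, which only used `0 ∉ A` of the `*`-hull);
* `Loewner.measurableSet_disjoint_closedHull_of_isCompact` — the alive event is measurable;
* `Loewner.measurableSet_subset_closedHull` — the event "`C` is wholly swallowed by time `t`" is
  measurable for any set `C` with a sequence of points of `C ∩ ℍ` dense in `C`.

## References

* [LSW] JAMS 16 (2003), §5 (`T = T_A`). [LawlerSchrammWerner2003Restriction]
* S. Rohde, O. Schramm, Ann. of Math. 161 (2005), §3 p. 896 (measurability in `σ(ξ(s), s ≤ t)`).
  [RohdeSchramm2005]
-/

noncomputable section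

open Set Filter Metric Function MeasureTheory
open _root_.Complex _root_.Topology
open UpperHalfPlane (upperHalfPlaneSet)
open scoped NNReal

namespace Literature.Probability.RandomPlanarGeometry

namespace Loewner

/-! ### Alive times of a compact set -/

section HitTime

variable {W : ℝ≥0 → ℝ} {N : Set ℂ}

/-- **The alive times of a compact set are exactly `[0, T_N)`**: at the finite hitting time some
point of `N` is already swallowed (`IsHullHitTime.exists_mem_closedHull`), and the closed hulls
increase. [cite: LawlerSchrammWerner2003Restriction, §5 (T = T_A)] -/
theorem disjoint_closedHull_iff_lt_hullHitTime_of_isCompact (hW : Continuous W) (hN : IsCompact N)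
    {s : ℝ≥0} : Disjoint (closedHull W s) N ↔ (s : WithTop ℝ≥0) < hullHitTime W N := by
  refine ⟨fun h ↦ ?_, disjoint_closedHull_of_lt_hullHitTime⟩
  by_contra hle
  rw [not_lt] at hle
  obtain ⟨τ, hτ⟩ := WithTop.ne_top_iff_exists.1 (ne_top_of_le_ne_top WithTop.coe_ne_top hle)
  obtain ⟨z, hzN, hzK⟩ := (isHullHitTime_of_hullHitTime_eq hτ.symm).exists_mem_closedHull hW hN
  have hτs : τ ≤ s := by rw [← hτ] at hle; exact WithTop.coe_le_coe.1 hle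
  exact Set.disjoint_left.1 h (closedHull_mono W hτs hzK) hzN

/-- At a finite hitting time of a compact set, the closed hull meets it. [folklore] -/
theorem not_disjoint_closedHull_of_hullHitTime_eq (hW : Continuous W) (hN : IsCompact N) {τ : ℝ≥0}
    (hτ : hullHitTime W N = τ) : ¬ Disjoint (closedHull W τ) N := fun h ↦ by
  have := (disjoint_closedHull_iff_lt_hullHitTime_of_isCompact hW hN).1 h
  rw [hτ] at this
  exact lt_irrefl _ this

/-- `T_N ≤ t` iff the closed hull at time `t` meets the compact set `N`. [folklore] -/
theorem hullHitTime_le_coe_iff_of_isCompact (hW : Continuous W) (hN : IsCompact N) {t : ℝ≥0} :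
    hullHitTime W N ≤ t ↔ ¬ Disjoint (closedHull W t) N := by
  rw [disjoint_closedHull_iff_lt_hullHitTime_of_isCompact hW hN, not_lt]

end HitTime

/-! ### A dense sequence in `N ∩ ℍ` -/

/-- A set which is in the closure of its (nonempty) part in `ℍ` contains a sequence of points of
`ℍ` dense in it. [folklore] -/
theorem exists_denseSeq_of_subset_closure {N : Set ℂ} (hcl : N ⊆ closure (N ∩ upperHalfPlaneSet))
    (hne : (N ∩ upperHalfPlaneSet).Nonempty) :
    ∃ a : ℕ → ℂ, (∀ k, a k ∈ N ∧ 0 < (a k).im) ∧ N ⊆ closure (range a) := by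
  -- adapted from `Loewner.exists_denseSeq` (`SLERestrictionAlive`)
  obtain ⟨t, hts, htc, hdense⟩ :=
    (TopologicalSpace.IsSeparable.of_separableSpace (N ∩ upperHalfPlaneSet)).exists_countable_dense_subset
  have htne : t.Nonempty := by
    by_contra h
    rw [not_nonempty_iff_eq_empty] at h
    rw [h, closure_empty] at hdense
    exact hne.ne_empty (subset_empty_iff.1 hdense)
  obtain ⟨a, rfl⟩ := htc.exists_eq_range htne
  refine ⟨a, fun k ↦ ⟨(hts ⟨k, rfl⟩).1, (hts ⟨k, rfl⟩).2⟩, ?_⟩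
  exact hcl.trans (closure_minimal hdense isClosed_closure)

/-! ### The alive event of a compact set is `{0 < aliveFn}` -/

/-- A point still flowing at time `t` has `g_t(z) ≠ W_t` (cf. `map_sub_driving_ne_zero` of
`SLERestrictionHitScales`). [folklore] -/
theorem map_sub_driving_ne_zero_of_lt {W : ℝ≥0 → ℝ} (hW : Continuous W) {t : ℝ≥0} {z : ℂ}
    (hz : (t : WithTop ℝ≥0) < swallowingTime W z) : map W t z - W t ≠ 0 := by
  obtain ⟨g, hg⟩ := exists_isSolution_swallowingTime_holds hW (ne_driving_of_lt_swallowingTime hz)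
  rw [map_eq_of_isSolution hW hg hz, sub_ne_zero]
  have := hg.ne t.coe_nonneg (by rw [Real.toNNReal_coe]; exact hz)
  rwa [Real.toNNReal_coe] at this

section AliveIff

variable {Ω : Type*} {W : Ω → ℝ≥0 → ℝ} {N : Set ℂ} {t : ℝ≥0} {a : ℕ → ℂ}

/-- **Alive ⇒ `aliveFn > 0`** for a compact `N ⊆ ℍ̄`: `(s, z) ↦ ‖g_s(z) − W_s‖` is continuous and
positive on the compact `[0, t] × N` (`continuousOn_map_prod`), hence bounded below by some `m > 0`,
and every clipped distance of a point of `N` at a time `≤ t` is at least `min m 1`. [folklore] -/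
theorem aliveFn_pos_of_disjoint_of_isCompact {ω : Ω} (hW : Continuous (W ω)) (hN : IsCompact N)
    (hNH : N ⊆ closure upperHalfPlaneSet) (ha : ∀ k, a k ∈ N) (ht : Disjoint (closedHull (W ω) t) N) :
    0 < aliveFn a W t ω := by
  classical
  have halive : ∀ z ∈ N, (t : WithTop ℝ≥0) < swallowingTime (W ω) z := fun z hz ↦
    lt_swallowingTime_of_disjoint_closedHull hNH ht hz
  -- the continuous positive function on the compact `[0, t] × N`
  set F : ℝ≥0 × ℂ → ℝ := fun p ↦ ‖map (W ω) p.1 p.2 - W ω p.1‖ with hF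
  have hK : IsCompact (Icc 0 t ×ˢ N) := isCompact_Icc.prod hN
  have hsub : Icc 0 t ×ˢ N ⊆ Iic t ×ˢ {z : ℂ | (t : WithTop ℝ≥0) < swallowingTime (W ω) z} :=
    prod_mono (fun s hs ↦ hs.2) fun z hz ↦ halive z hz
  have hFc : ContinuousOn F (Icc 0 t ×ˢ N) := by
    refine ContinuousOn.norm (((continuousOn_map_prod hW).mono hsub).sub ?_)
    exact (Complex.continuous_ofReal.comp (hW.comp continuous_fst)).continuousOn
  have hKne : (Icc 0 t ×ˢ N).Nonempty := ⟨(0, a 0), ⟨⟨le_rfl, zero_le⟩, ha 0⟩⟩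
  obtain ⟨p₀, hp₀, hmin⟩ := hK.exists_isMinOn hKne hFc
  have hm : 0 < F p₀ := by
    have hlt : (p₀.1 : WithTop ℝ≥0) < swallowingTime (W ω) p₀.2 :=
      lt_of_le_of_lt (WithTop.coe_le_coe.2 hp₀.1.2) (halive _ hp₀.2)
    exact norm_pos_iff.2 (map_sub_driving_ne_zero_of_lt hW hlt)
  have hlow : ∀ k (q : ℝ≥0), q ≤ t → min (F p₀) 1 ≤ clipDist a W k q ω := by
    intro k q hq
    have hlt : (q : WithTop ℝ≥0) < swallowingTime (W ω) (a k) :=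
      lt_of_le_of_lt (WithTop.coe_le_coe.2 hq) (halive _ (ha k))
    rw [clipDist, if_pos hlt]
    exact min_le_min (hmin (show (q, a k) ∈ Icc 0 t ×ˢ N from ⟨⟨zero_le, hq⟩, ha k⟩)) le_rfl
  exact lt_of_lt_of_le (lt_min hm one_pos) (le_aliveFn a W ω hlow)

/-- **Not alive ⇒ `aliveFn = 0`** for a set `N ∌ 0` in which the points `a k ∈ ℍ` are dense: if
some point of `N` (possibly real) is swallowed at a time `τ ≤ t`, then for every `ε > 0` some
clipped distance `ψ_{k,q}`, `q ∈ ℚ ∩ [0, t]`, is `< ε`. The proof is that of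
`Loewner.aliveFn_lt_of_not_disjoint` (`SLERestrictionAlive`), which used the `*`-hull hypothesis
only through `0 ∉ A`. [folklore] -/
theorem aliveFn_lt_of_not_disjoint_of_zero_notMem {ω : Ω} (hW : Continuous (W ω)) (hW0 : W ω 0 = 0)
    (h0 : (0 : ℂ) ∉ N) (hdense : N ⊆ closure (range a)) (haH : ∀ k, 0 < (a k).im)
    (ht : ¬ Disjoint (closedHull (W ω) t) N) {ε : ℝ} (hε : 0 < ε) : aliveFn a W t ω < ε := by
  -- adapted from `Loewner.aliveFn_lt_of_not_disjoint` (`SLERestrictionAlive`)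
  classical
  -- a swallowed point `z ∈ N`, swallowed at `τ ≤ t`, `0 < τ`
  obtain ⟨z, hzK, hzA⟩ := Set.not_disjoint_iff.1 ht
  obtain ⟨hzim, hzT⟩ : 0 ≤ z.im ∧ swallowingTime (W ω) z ≤ (t : WithTop ℝ≥0) := hzK
  have hTtop : swallowingTime (W ω) z ≠ ⊤ := ne_top_of_le_ne_top (WithTop.coe_ne_top) hzT
  obtain ⟨τ, hτ⟩ := WithTop.ne_top_iff_exists.1 hTtop
  have hτ' : swallowingTime (W ω) z = τ := hτ.symm
  have hτt : τ ≤ t := by rw [hτ'] at hzT; exact_mod_cast hzT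
  have hz0 : z ≠ W ω 0 := by
    rw [hW0]; intro h
    exact h0 (by rw [Complex.ofReal_zero] at h; rwa [← h])
  have hτpos : 0 < τ := by
    have := swallowingTime_pos_holds hW hz0
    rw [hτ'] at this; exact_mod_cast this
  -- the maximal solution from `z` comes `ε/2`-close to the driver before `τ`
  obtain ⟨G, hG⟩ := exists_isSolution_swallowingTime_holds hW hz0
  rw [hτ'] at hG
  have hε2 : (0 : ℝ) < ε / 2 := by positivity
  obtain ⟨s, hs0, hsτ, hclose⟩ : ∃ s : ℝ, 0 ≤ s ∧ s < τ ∧ ‖G s - W ω s.toNNReal‖ < ε / 2 := by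
    by_contra hcon
    push Not at hcon
    have := hG.coe_lt_swallowingTime_of_le_norm_sub hW hτpos (δ := ⟨ε / 2, hε2.le⟩) hε2 fun r hr0 hrτ ↦ hcon r hr0 hrτ
    rw [hτ'] at this
    exact lt_irrefl _ this
  set s' : ℝ≥0 := s.toNNReal with hs'
  have hss' : (s' : ℝ) = s := Real.coe_toNNReal s hs0
  have hs'τ : s' < τ := by rw [← NNReal.coe_lt_coe, hss']; exact hsτ
  have hs't : s' < t := lt_of_lt_of_le hs'τ hτt
  have hs'T : (s' : WithTop ℝ≥0) < swallowingTime (W ω) z := by rw [hτ']; exact_mod_cast hs'τ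
  have hmapz : map (W ω) s' z = G s := by rw [map_eq_of_isSolution hW hG (by exact_mod_cast hs'τ), hss']
  -- continuity of `g_{s'}` at `z`
  have hcz := continuousAt_map hW hs'T
  rw [Metric.continuousAt_iff] at hcz
  obtain ⟨δ₁, hδ₁, hδ₁z⟩ := hcz (ε / 4) (by positivity)
  -- `z ∉ closedHull_{s'}`, an open condition
  have hzK' : z ∉ closedHull (W ω) s' := fun h ↦ by
    have : swallowingTime (W ω) z ≤ (s' : WithTop ℝ≥0) := h.2
    exact (not_le.2 hs'T) this
  obtain ⟨δ₂, hδ₂, hball⟩ := Metric.isOpen_iff.1 (isClosed_closedHull hW s').isOpen_compl z hzK'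
  -- a point `a k` close to `z`
  obtain ⟨_, ⟨k, rfl⟩, hk⟩ := Metric.mem_closure_iff.1 (hdense hzA) (min δ₁ δ₂) (lt_min hδ₁ hδ₂)
  have hk1 : dist (a k) z < δ₁ := by rw [dist_comm]; exact lt_of_lt_of_le hk (min_le_left _ _)
  have hk2 : a k ∉ closedHull (W ω) s' := hball (mem_ball.2 (by rw [dist_comm]; exact lt_of_lt_of_le hk (min_le_right _ _)))
  have hkT : (s' : WithTop ℝ≥0) < swallowingTime (W ω) (a k) := by
    by_contra h
    exact hk2 ⟨(haH k).le, not_lt.1 h⟩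
  have hbound_s' : ‖map (W ω) s' (a k) - W ω s'‖ < 3 * ε / 4 := by
    have h1 : dist (map (W ω) s' (a k)) (map (W ω) s' z) < ε / 4 := hδ₁z hk1
    rw [dist_eq_norm] at h1
    have h2 : ‖map (W ω) s' z - W ω s'‖ < ε / 2 := by
      rw [hmapz]
      have : ((W ω s' : ℝ) : ℂ) = W ω s.toNNReal := by rw [hs']
      rw [this]; exact hclose
    calc ‖map (W ω) s' (a k) - W ω s'‖ = ‖(map (W ω) s' (a k) - map (W ω) s' z) + (map (W ω) s' z - W ω s')‖ := by ring_nf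
      _ ≤ ‖map (W ω) s' (a k) - map (W ω) s' z‖ + ‖map (W ω) s' z - W ω s'‖ := norm_add_le _ _
      _ < 3 * ε / 4 := by linarith
  -- continuity in time of the flow of `a k` at `s'`
  have hk0 : a k ≠ W ω 0 := ne_driving_of_lt_swallowingTime hkT
  obtain ⟨Gk, hGk⟩ := exists_isSolution_swallowingTime_holds hW hk0
  have hdom : s ∈ {r : ℝ | 0 ≤ r ∧ (r.toNNReal : WithTop ℝ≥0) < swallowingTime (W ω) (a k)} := ⟨hs0, hkT⟩
  have hcontk : ContinuousWithinAt (fun r : ℝ ↦ Gk r - W ω r.toNNReal)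
      {r : ℝ | 0 ≤ r ∧ (r.toNNReal : WithTop ℝ≥0) < swallowingTime (W ω) (a k)} s :=
    (hGk.continuousOn s hdom).sub ((Complex.continuous_ofReal.comp (hW.comp continuous_real_toNNReal)).continuousWithinAt)
  rw [Metric.continuousWithinAt_iff] at hcontk
  obtain ⟨δ₃, hδ₃, hδ₃s⟩ := hcontk (ε / 8) (by positivity)
  -- room before `T_{a k}` and before `t`
  obtain ⟨δ₄, hδ₄, hδ₄T⟩ : ∃ δ₄ : ℝ, 0 < δ₄ ∧ ∀ r : ℝ, s ≤ r → r < s + δ₄ →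
      (r.toNNReal : WithTop ℝ≥0) < swallowingTime (W ω) (a k) := by
    rcases eq_or_ne (swallowingTime (W ω) (a k)) ⊤ with htop | hnt
    · exact ⟨1, one_pos, fun r _ _ ↦ by rw [htop]; exact WithTop.coe_lt_top _⟩
    · obtain ⟨σ, hσ⟩ := WithTop.ne_top_iff_exists.1 hnt
      have hsσ : s < σ := by
        have : (s' : WithTop ℝ≥0) < σ := by rw [hσ]; exact hkT
        have h' : s' < σ := by exact_mod_cast this
        rw [← NNReal.coe_lt_coe, hss'] at h'; exact h'
      refine ⟨(σ - s) / 2, by linarith, fun r hr1 hr2 ↦ ?_⟩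
      rw [← hσ, WithTop.coe_lt_coe, ← NNReal.coe_lt_coe, Real.coe_toNNReal r (hs0.trans hr1)]
      linarith
  set δ : ℝ := min δ₃ (min δ₄ ((t : ℝ) - s)) with hδ
  have hδ0 : 0 < δ := by
    refine lt_min hδ₃ (lt_min hδ₄ ?_)
    have : (s' : ℝ) < t := by exact_mod_cast hs't
    rw [hss'] at this; linarith
  obtain ⟨q, hsq, hqs⟩ := exists_rat_btwn (show s < s + δ by linarith)
  have hq0 : 0 ≤ (q : ℝ) := hs0.trans hsq.le
  have hqt : (q : ℝ) ≤ t := by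
    have := min_le_right δ₄ ((t : ℝ) - s)
    have := min_le_right δ₃ (min δ₄ ((t : ℝ) - s))
    linarith
  have hqT : ((q : ℝ).toNNReal : WithTop ℝ≥0) < swallowingTime (W ω) (a k) :=
    hδ₄T q hsq.le (by have := min_le_left δ₄ ((t:ℝ) - s); have := min_le_right δ₃ (min δ₄ ((t : ℝ) - s)); linarith)
  have hqdist : dist (q : ℝ) s < δ₃ := by
    rw [Real.dist_eq, abs_of_pos (by linarith)]
    have := min_le_left δ₃ (min δ₄ ((t : ℝ) - s)); linarith
  have hnear := hδ₃s ⟨hq0, hqT⟩ hqdist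
  rw [dist_eq_norm] at hnear
  -- the clipped distance at `(k, q)` is `< ε`
  set q' : ratTimes t := ⟨q, hq0, hqt⟩ with hq'
  have hqval : (q'.val : ℝ≥0) = (q : ℝ).toNNReal := by
    apply NNReal.eq; rw [Real.coe_toNNReal _ hq0]; rfl
  have hmapk : map (W ω) q'.val (a k) = Gk q := by
    rw [hqval, map_eq_of_isSolution hW hGk hqT, Real.coe_toNNReal _ hq0]
  have hmaps : map (W ω) s' (a k) = Gk s := by
    rw [map_eq_of_isSolution hW hGk (by rw [hs']; exact hkT), hss']
  have hlt : (q'.val : WithTop ℝ≥0) < swallowingTime (W ω) (a k) := by rw [hqval]; exact hqT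
  have hclip : clipDist a W k q'.val ω < ε := by
    rw [clipDist, if_pos hlt]
    refine lt_of_le_of_lt (min_le_left _ _) ?_
    have hWq : ((W ω q'.val : ℝ) : ℂ) = W ω (q : ℝ).toNNReal := by rw [hqval]
    rw [hmapk, hWq]
    have hWs : ((W ω s' : ℝ) : ℂ) = W ω s.toNNReal := by rw [hs']
    rw [hmaps, hWs] at hbound_s'
    calc ‖Gk q - W ω (q : ℝ).toNNReal‖ = ‖(Gk q - W ω (q : ℝ).toNNReal - (Gk s - W ω s.toNNReal)) + (Gk s - W ω s.toNNReal)‖ := by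
          ring_nf
      _ ≤ ‖Gk q - W ω (q : ℝ).toNNReal - (Gk s - W ω s.toNNReal)‖ + ‖Gk s - W ω s.toNNReal‖ := norm_add_le _ _
      _ < ε := by linarith
  exact lt_of_le_of_lt (aliveFn_le_clipDist_rat a W ω k q') hclip

/-- **The alive event of a compact set `N ⊆ ℍ̄` with `0 ∉ N` is `{0 < aliveFn}`**, for the alive
functional of any sequence of points of `N ∩ ℍ` dense in `N`.
[cite: LawlerSchrammWerner2003Restriction, §5 (t < T_A)] -/
theorem disjoint_closedHull_iff_aliveFn_pos_of_isCompact {ω : Ω} (hW : Continuous (W ω))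
    (hW0 : W ω 0 = 0) (hN : IsCompact N) (hNH : N ⊆ closure upperHalfPlaneSet) (h0 : (0 : ℂ) ∉ N)
    (ha : ∀ k, a k ∈ N ∧ 0 < (a k).im) (hdense : N ⊆ closure (range a)) :
    Disjoint (closedHull (W ω) t) N ↔ 0 < aliveFn a W t ω := by
  refine ⟨fun h ↦ aliveFn_pos_of_disjoint_of_isCompact hW hN hNH (fun k ↦ (ha k).1) h, fun h ↦ ?_⟩
  by_contra hnot
  exact lt_irrefl _ (aliveFn_lt_of_not_disjoint_of_zero_notMem hW hW0 h0 hdense (fun k ↦ (ha k).2) hnot h)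

end AliveIff

/-! ### Measurability of the alive event and of the whole-swallow event -/

section Measurable

variable {Ω : Type*} {mΩ : MeasurableSpace Ω} {W : Ω → ℝ≥0 → ℝ} {N : Set ℂ} {t : ℝ≥0}

/-- **The alive event `{ω | K̂_t(W ω) ∩ N = ∅}` of a compact set `N ⊆ ℍ̄` with `0 ∉ N` and
`N ⊆ closure (N ∩ ℍ)` is measurable** with respect to any σ-algebra making the path values at
times `≤ t` measurable (continuous paths from `0`).
[cite: LawlerSchrammWerner2003Restriction, §5 (T_A)] -/
theorem measurableSet_disjoint_closedHull_of_isCompact (hc : ∀ ω, Continuous (W ω))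
    (hW0 : ∀ ω, W ω 0 = 0) (hmeas : ∀ s, s ≤ t → Measurable fun ω ↦ W ω s) (hN : IsCompact N)
    (hNH : N ⊆ closure upperHalfPlaneSet) (h0 : (0 : ℂ) ∉ N)
    (hcl : N ⊆ closure (N ∩ upperHalfPlaneSet)) :
    MeasurableSet {ω | Disjoint (closedHull (W ω) t) N} := by
  rcases (N ∩ upperHalfPlaneSet).eq_empty_or_nonempty with hemp | hne
  · have hN0 : N = ∅ := subset_empty_iff.1 (by simpa [hemp] using hcl)
    have : {ω | Disjoint (closedHull (W ω) t) N} = univ :=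
      eq_univ_of_forall fun ω ↦ by rw [mem_setOf_eq, hN0]; exact disjoint_bot_right
    rw [this]
    exact MeasurableSet.univ
  · obtain ⟨a, ha, hdense⟩ := exists_denseSeq_of_subset_closure hcl hne
    have : {ω | Disjoint (closedHull (W ω) t) N} = {ω | 0 < aliveFn a W t ω} := by
      ext ω
      exact disjoint_closedHull_iff_aliveFn_pos_of_isCompact (hc ω) (hW0 ω) hN hNH h0 ha hdense
    rw [this]
    exact measurableSet_lt measurable_const (measurable_aliveFn hc hmeas fun k ↦ (ha k).2)

/-- **The whole-swallow event `{ω | C ⊆ K̂_t(W ω)}` is measurable** for a set `C` containing a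
sequence of points of `ℍ` dense in it: since `K̂_t` is closed, `C ⊆ K̂_t` iff every point of the
sequence is swallowed by time `t`. [folklore] -/
theorem measurableSet_subset_closedHull (hc : ∀ ω, Continuous (W ω))
    (hmeas : ∀ s, s ≤ t → Measurable fun ω ↦ W ω s) {C : Set ℂ} {e : ℕ → ℂ}
    (he : ∀ k, e k ∈ C ∧ 0 < (e k).im) (hdense : C ⊆ closure (range e)) :
    MeasurableSet {ω | C ⊆ closedHull (W ω) t} := by
  have heq : {ω | C ⊆ closedHull (W ω) t} =
      ⋂ k, {ω | (t : WithTop ℝ≥0) < swallowingTime (W ω) (e k)}ᶜ := by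
    ext ω
    simp only [mem_setOf_eq, mem_iInter, mem_compl_iff, not_lt]
    constructor
    · intro h k
      exact (h (he k).1).2
    · intro h
      have hrange : range e ⊆ closedHull (W ω) t := by
        rintro _ ⟨k, rfl⟩
        exact ⟨(he k).2.le, h k⟩
      exact hdense.trans (closure_minimal hrange (isClosed_closedHull (hc ω) t))
  rw [heq]
  exact MeasurableSet.iInter fun k ↦ (measurableSet_lt_swallowingTime_of_im_pos hc hmeas (he k).2).compl

/-- The contact event `{ω | K̂_t(W ω) ∩ N ≠ ∅}` of a compact sensor is measurable. [folklore] -/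
theorem measurableSet_not_disjoint_closedHull_of_isCompact (hc : ∀ ω, Continuous (W ω))
    (hW0 : ∀ ω, W ω 0 = 0) (hmeas : ∀ s, s ≤ t → Measurable fun ω ↦ W ω s) (hN : IsCompact N)
    (hNH : N ⊆ closure upperHalfPlaneSet) (h0 : (0 : ℂ) ∉ N)
    (hcl : N ⊆ closure (N ∩ upperHalfPlaneSet)) :
    MeasurableSet {ω | ¬ Disjoint (closedHull (W ω) t) N} :=
  (measurableSet_disjoint_closedHull_of_isCompact hc hW0 hmeas hN hNH h0 hcl).compl

end Measurable

end Loewner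

end Literature.Probability.RandomPlanarGeometry

end
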